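import Summits.QuantumAdvantage.QuantumAdvantage.Theorems.ArithStatLadderIqThreeNotPPolyStubInfluenceTail
import Summits.QuantumAdvantage.QuantumAdvantage.Theorems.ArithStatLadderIqThreeNotPPolyStubInfluenceAC0
import Summits.QuantumAdvantage.QuantumAdvantage.Theorems.ArithStatLadderIqThreeNotPPolyStubShiftPairsCount
import Summits.QuantumAdvantage.QuantumAdvantage.Theorems.ArithStatLadderIqThreeNotPPolyStubShiftPairsCube
import Summits.QuantumAdvantage.QuantumAdvantage.Theorems.ArithStatLadderIqThreeNotPPolyApexBQP
import Literature.Computability.Complexity.ACC0SubsetPPoly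

/-!
# Crux `ArithStatLadder.IqThreeNotPPoly` (stmt-QuantumAdvantage-2422): the apex's `AC⁰` rung

Line `Sketch` closes the crux `IQ3 ∉ P/poly` modulo its apex `SQUAREFREES ∉ P/poly`
(`stub_sqfreeNotPPoly`, hypothesis-type: an explicit super-polynomial circuit lower bound, of
strength `NP ⊄ P/poly`, `ArithStatLadderIqThreeNotPPolyApexNP.lean`). This file EARNS the apex's
first unconditional rung — its constant-depth shadow is a theorem:

* `squarefree_not_mem_AC0` — **`SQUAREFREES ∉ AC⁰`**: the language of LSB-first binary numerals of
  squarefree integers is decided by no constant-depth, polynomial-size family of unbounded fan-in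
  `∧/∨/¬` circuits (Bernasconi–Damm–Shparlinski 2000: linear average sensitivity of
  square-freeness, hence not in `AC⁰` by Boppana 1997 / Linial–Mansour–Nisan 1993);
* `fund_not_mem_AC0` — the same for `FUND = bin {d : −d is a fundamental discriminant}`, the
  language the disprover's genus-theory collapse identifies with the `ℓ = 2` analogue of the crux
  (`Negative/GenusTwoCollapse.lean`).

## Proof (average sensitivity, kernel-checked from four registered rung stubs of skeleton v7)

Total influence `I[f] = Σ_i Pr_x[f(x) ≠ f(x^{⊕i})]` of a Boolean function on the cube `{0,1}ⁿ`.
* R1 `stub_influenceTail` (Fourier analysis, O'Donnell 2014 §2.3): `I[f] = Σ_S |S| f̂(S)²`, hence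
  `I[f] ≤ k + n · W^{≥k+1}[f]` for every level `k`.
* R2 `stub_influenceAC0`: with A. Tal's Fourier-tail bound for `acBasis` circuits — PROVED in the
  tree (`Literature.NumberTheory.Sieve.GreenAC0.tailWeight_circuit_le`, i.e. Tal 2017 Thm. 3.6
  through `ACForm.tailWeight_le_tailBound`, with the asymptotics
  `MobiusLadder.tail_term_eventually`) — every depth-`d`, size-`p(n)` circuit has `I ≤ δ n`
  eventually, for every `δ > 0` (Boppana 1997 / Linial–Mansour–Nisan 1993 in Tal's constants).
* R3 `stub_shiftPairsCount` (elementary number theory): for `n ≥ n₀` and every position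
  `n/2 + 8 ≤ j ≤ n − 2` there are `≥ 2ⁿ/512` numerals `N ∈ [2^{n-1}, 2ⁿ)` with `N ≡ 3 (4)`, bit `j`
  zero, `N` squarefree and `9 ∣ N + 2ʲ` — the AP squarefree sieve `stub_apSieve` (modulus `36`,
  `p₀ = 5`) in each of the `2^{n-2-j}` dyadic blocks; the `√(2ⁿ)` error is harmless as
  `j ≥ n/2 + 8`.
* R4 `stub_shiftPairsCube`: each such `N` is a point of the cube at which the indicator of `bin A`
  is sensitive to bit `j` (`N ↦ N + 2ʲ` sets bit `j` only; numerals `≥ 2^{n-1}` are codewords).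
Assembly (`not_mem_AC0_of_shiftPairs`): a deciding family has `I ≤ n/2048` on large `n` (R2) but
`I ≥ (#positions)·(1/512) ≥ (n/2 − 10)/512` (R3 + R4 + `CircuitFamily.Decides.eval_eq`) —
contradiction for `n ≥ 64`. Written once for any `A ⊆ ℕ` sandwiched as
`{N ≡ 3 (4), N squarefree} ⊆ A` and `A ∩ {N ≡ 3 (4)} ⊆ {squarefree}`, which covers both
`A = {squarefree}` and `A = FUND` (`isNegFundamentalDiscr_iff_squarefree_of_mod_four`).

## References

* A. Bernasconi, C. Damm, I. E. Shparlinski, *The average sensitivity of square-freeness*,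
  Comput. Complexity 9 (2000) 39–51 [BernasconiDammShparlinski2000].
* A. Bernasconi, C. Damm, I. Shparlinski, *Circuit and decision tree complexity of some number
  theoretic problems*, Inform. and Comput. 168 (2001) 113–124 [BernasconiDammShparlinski2001].
* R. B. Boppana, *The average sensitivity of bounded-depth circuits*, IPL 63 (1997) 257–261 [Boppana1997].
* A. Tal, *Tight bounds on the Fourier spectrum of AC⁰*, CCC 2017, Thm. 3.6 [Tal2017].
* R. O'Donnell, *Analysis of Boolean Functions*, CUP 2014, §2.3 [ODonnell2014].
-/

set_option linter.dupNamespace false -- D-0017: single-problem summit ⇒ `QuantumAdvantage.QuantumAdvantage` by design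

noncomputable section

namespace Summit.QuantumAdvantage.QuantumAdvantage.Theorems.IqThreeNotPPoly

open scoped Classical BigOperators
open _root_.Computability
open Literature.Computability.Complexity
open Literature.Computability.Cryptography (IsNegFundamentalDiscr)

/-- `9 ∣ m` kills squarefreeness (`9 = 3·3`, `3` is not a unit). [folklore] -/
theorem apexAC0_not_squarefree_of_nine_dvd {m : ℕ} (h : 9 ∣ m) : ¬ Squarefree m := by
  intro hsq
  have h33 : 3 * 3 ∣ m := by simpa using h
  have := hsq 3 h33
  norm_num at this

/-- **Average-sensitivity lower bound ⇒ not in `AC⁰` (generic core).** Let `A ⊆ ℕ` and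
suppose that for all large `n` and every position `(n + w)/2 ≤ j ≤ n − 2` a set `good n j` of at
least `2ⁿ/K` numerals `N < 2ⁿ` is given with `2^{n-1} ≤ N`, bit `j` of `N` zero, `N ∈ A` and
`N + 2ʲ ∉ A`. Then `bin A ∉ AC⁰`: a deciding constant-depth polynomial-size family over `acBasis`
would have total influence `≤ n/(4K)` at a large length `n` (R2 = `stub_influenceAC0` fed with
R1 = `stub_influenceTail`), yet at each of the `≥ (n − w − 3)/2` good positions at least `2ⁿ/K`
points of the cube are bit-`j`-sensitive (R4 = `stub_shiftPairsCube` and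
`CircuitFamily.Decides.eval_eq`): `(n − w − 3)/(2K) ≤ n/(4K)` fails for `n > 2w + 6`.
[cite: BernasconiDammShparlinski2000, §1 (main theorem)] [cite: Boppana1997, Thm. 1] [cite: Tal2017, Thm. 3.6] -/
theorem not_mem_AC0_of_sensitive_numerals (A : Set ℕ) (K w : ℕ) (hK : 0 < K)
    (good : ℕ → ℕ → Finset ℕ)
    (hgood : ∀ n j : ℕ, good n j ⊆ (Finset.range (2 ^ n)).filter (fun N : ℕ =>
      2 ^ (n - 1) ≤ N ∧ N.testBit j = false ∧ N ∈ A ∧ N + 2 ^ j ∉ A))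
    (hcount : ∃ n₀ : ℕ, ∀ n : ℕ, n₀ ≤ n → ∀ j : ℕ, n + w ≤ 2 * j → j + 2 ≤ n →
      2 ^ n ≤ K * (good n j).card) :
    encodingNatBool.toLanguage A ∉ AC0 := by
  rintro ⟨d, p, C, hC, hdec⟩
  obtain ⟨n₀, h3⟩ := hcount
  have hKR : (0 : ℝ) < K := by exact_mod_cast hK
  have hev := stub_influenceAC0 stub_influenceTail d p (1 / (4 * K)) (by positivity)
  obtain ⟨n, ⟨hn₀, hn64⟩, hI⟩ :=
    (((Filter.eventually_ge_atTop n₀).and (Filter.eventually_ge_atTop (2 * w + 64))).and hev).exists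
  have hIn := hI (C n) (hC n).1 (hC n).2.1 (hC n).2.2
  -- the summand, as a function of the position
  set c : Fin n → ℝ := fun i => ((Finset.univ.filter
      (fun x : Fin n → Bool => (C n).eval x ≠ (C n).eval (Function.update x i (!x i)))).card : ℝ)
    with hc
  have hc0 : ∀ i, 0 ≤ c i := fun i => by rw [hc]; positivity
  -- each good position carries at least `2ⁿ/K` sensitive points
  have hpos : ∀ i : Fin n, n + w ≤ 2 * (i : ℕ) → (i : ℕ) + 2 ≤ n → (2 : ℝ) ^ n / K ≤ c i := by
    intro i hi1 hi2
    have hA := h3 n hn₀ i hi1 hi2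
    have hB := stub_shiftPairsCube n i A
    -- the deciding circuit computes the language's indicator on the cube
    have e : ∀ u : Fin n → Bool, (C n).eval u =
        (encodingNatBool.toLanguage A).boolIndicator (List.ofFn u) := fun u => hdec.eval_eq u
    have hnat : 2 ^ n ≤ K * (Finset.univ.filter (fun x : Fin n → Bool =>
        (C n).eval x ≠ (C n).eval (Function.update x i (!x i)))).card := by
      refine hA.trans (Nat.mul_le_mul_left K
        (le_trans (Finset.card_le_card (hgood n i)) (hB.trans (le_of_eq ?_))))
      simp only [e]
    have hreal : (2 : ℝ) ^ n ≤ K * c i := by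
      show (2 : ℝ) ^ n ≤ K * ((Finset.univ.filter (fun x : Fin n → Bool =>
        (C n).eval x ≠ (C n).eval (Function.update x i (!x i)))).card : ℝ)
      exact_mod_cast hnat
    rw [div_le_iff₀ hKR]
    linarith
  -- the good positions: `a ≤ j ≤ n - 2`, `a = (n + w + 1) / 2`
  set a : ℕ := (n + w + 1) / 2 with ha
  have ha2 : 2 * a ≤ n + w + 1 := by omega
  set J : Finset (Fin n) := (Finset.Ico a (n - 1)).attachFin (fun m hm => by
      rw [Finset.mem_Ico] at hm; omega) with hJ
  have hJcard : J.card = n - 1 - a := by rw [hJ, Finset.card_attachFin, Nat.card_Ico]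
  have hJmem : ∀ i ∈ J, n + w ≤ 2 * (i : ℕ) ∧ (i : ℕ) + 2 ≤ n := by
    intro i hi
    rw [hJ, Finset.mem_attachFin, Finset.mem_Ico] at hi
    omega
  have hlow : (J.card : ℝ) * ((2 : ℝ) ^ n / K) ≤ ∑ i : Fin n, c i := by
    calc (J.card : ℝ) * ((2 : ℝ) ^ n / K) = ∑ i ∈ J, (2 : ℝ) ^ n / K := by
          rw [Finset.sum_const, nsmul_eq_mul]
      _ ≤ ∑ i ∈ J, c i := Finset.sum_le_sum fun i hi => hpos i (hJmem i hi).1 (hJmem i hi).2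
      _ ≤ ∑ i : Fin n, c i :=
          Finset.sum_le_sum_of_subset_of_nonneg (Finset.subset_univ J) fun i _ _ => hc0 i
  have hup : (∑ i : Fin n, c i) / 2 ^ n ≤ 1 / (4 * K) * n := by simpa [hc] using hIn
  have h2n : (0 : ℝ) < 2 ^ n := by positivity
  rw [div_le_iff₀ h2n] at hup
  have hcardR : ((n : ℝ) - 1 - a) = (J.card : ℝ) := by
    rw [hJcard]
    push_cast [Nat.cast_sub (show a ≤ n - 1 by omega), Nat.cast_sub (show 1 ≤ n by omega)]
    ring
  have ha2R : 2 * (a : ℝ) ≤ n + w + 1 := by exact_mod_cast ha2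
  have hn64R : 2 * (w : ℝ) + 64 ≤ n := by exact_mod_cast hn64
  -- multiply through by `K > 0`: with `T := 2ⁿ / K`, `hlow` reads `J.card * T ≤ Σ c`
  have hT : (2 : ℝ) ^ n = K * ((2 : ℝ) ^ n / K) := by field_simp
  set T : ℝ := (2 : ℝ) ^ n / K with hTdef
  have hT0 : 0 < T := by rw [hTdef]; positivity
  have hup' : ∑ i : Fin n, c i ≤ (n : ℝ) / 4 * T := by
    rw [hT] at hup
    have : 1 / (4 * (K : ℝ)) * n * (K * T) = (n : ℝ) / 4 * T := by field_simp
    linarith [hup, this]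
  have P1 : 0 ≤ ((n : ℝ) + w + 1 - 2 * a) * T := mul_nonneg (by linarith) hT0.le
  have P2 : 0 ≤ ((n : ℝ) - 2 * w - 64) * T := mul_nonneg (by linarith) hT0.le
  have P3 : ((n : ℝ) - 1 - a) * T = (J.card : ℝ) * T := by rw [hcardR]
  linarith [hlow, hup', P1, P2, P3, hT0]

/-- The shifted-pair set of R3 (`stub_shiftPairsCount`): numerals `N < 2ⁿ` with `2^{n-1} ≤ N`,
`N ≡ 3 (4)`, bit `j` zero, `N` squarefree and `9 ∣ N + 2ʲ`. For any `A` sandwiched as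
`{N ≡ 3 (4), N squarefree} ⊆ A` and `A ∩ {N ≡ 3 (4)} ⊆ {squarefree}` these are sensitive numerals
of `bin A` (`N ∈ A`, and `N + 2ʲ ≡ 3 (4)` is not squarefree, so `∉ A`). [folklore] -/
theorem shiftPairs_subset_sensitive (A : Set ℕ)
    (hin : ∀ N : ℕ, N % 4 = 3 → Squarefree N → N ∈ A)
    (hout : ∀ N : ℕ, N % 4 = 3 → N ∈ A → Squarefree N) (n j : ℕ) (hj : 2 ≤ j) :
    (Finset.range (2 ^ n)).filter (fun N : ℕ =>
        2 ^ (n - 1) ≤ N ∧ N % 4 = 3 ∧ N.testBit j = false ∧ Squarefree N ∧ 9 ∣ N + 2 ^ j) ⊆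
      (Finset.range (2 ^ n)).filter (fun N : ℕ =>
        2 ^ (n - 1) ≤ N ∧ N.testBit j = false ∧ N ∈ A ∧ N + 2 ^ j ∉ A) := by
  intro N hN
  simp only [Finset.mem_filter] at hN ⊢
  obtain ⟨hr, h1, h2, h3, h4, h5⟩ := hN
  refine ⟨hr, h1, h3, hin N h2 h4, fun hmem => ?_⟩
  have h4j : 4 ∣ 2 ^ j := by
    obtain ⟨t, ht⟩ := Nat.exists_eq_add_of_le hj
    exact Dvd.intro (2 ^ t) (by rw [ht, pow_add]; norm_num)
  have hmod : (N + 2 ^ j) % 4 = 3 := by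
    obtain ⟨t, ht⟩ := h4j
    omega
  exact apexAC0_not_squarefree_of_nine_dvd h5 (hout _ hmod hmem)

/-- **Sandwich form**: any `A ⊆ ℕ` with `{N ≡ 3 (4), N squarefree} ⊆ A` and
`A ∩ {N ≡ 3 (4)} ⊆ {squarefree}` has `bin A ∉ AC⁰` (core with `K = 512`, `w = 16` + R3
`stub_shiftPairsCount`; positions below `2` never occur since `j ≥ n/2 + 8`). [cite: BernasconiDammShparlinski2000, §1 (main theorem)] -/
theorem not_mem_AC0_of_shiftPairs (A : Set ℕ)
    (hin : ∀ N : ℕ, N % 4 = 3 → Squarefree N → N ∈ A)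
    (hout : ∀ N : ℕ, N % 4 = 3 → N ∈ A → Squarefree N) :
    encodingNatBool.toLanguage A ∉ AC0 := by
  refine not_mem_AC0_of_sensitive_numerals A 512 16 (by norm_num)
    (fun n j => if 2 ≤ j then (Finset.range (2 ^ n)).filter (fun N : ℕ =>
        2 ^ (n - 1) ≤ N ∧ N % 4 = 3 ∧ N.testBit j = false ∧ Squarefree N ∧ 9 ∣ N + 2 ^ j) else ∅)
    (fun n j => ?_) ?_
  · by_cases hj : 2 ≤ j
    · rw [if_pos hj]; exact shiftPairs_subset_sensitive A hin hout n j hj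
    · rw [if_neg hj]; exact Finset.empty_subset _
  · obtain ⟨n₀, h⟩ := stub_shiftPairsCount
    refine ⟨n₀, fun n hn j hj1 hj2 => ?_⟩
    rw [if_pos (by omega)]
    convert h n hn j hj1 hj2 using 5

/-- **`SQUAREFREES ∉ AC⁰`** (Bernasconi–Damm–Shparlinski 2000/2001): the
language of binary numerals of squarefree integers is not decided by any constant-depth,
polynomial-size circuit family over `∧, ∨, ¬` of unbounded fan-in — the first PROVED rung under
the apex `stub_sqfreeNotPPoly` (`SQUAREFREES ∉ P/poly`) of line `Sketch`.
[cite: BernasconiDammShparlinski2000, §1 (main theorem)] [cite: BernasconiDammShparlinski2001, §1] -/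
theorem squarefree_not_mem_AC0 : encodingNatBool.toLanguage {m : ℕ | Squarefree m} ∉ AC0 :=
  not_mem_AC0_of_shiftPairs {m : ℕ | Squarefree m} (fun _ _ h => h) (fun _ _ h => h)

/-- **`FUND ∉ AC⁰`**: the language of `d` with `−d` a (negative) fundamental discriminant is not in
`AC⁰` — on `d ≡ 3 (mod 4)` fundamentality is squarefreeness
(`isNegFundamentalDiscr_iff_squarefree_of_mod_four`), which is all the sandwich needs. With the
disprover's genus-theory collapse (`Negative/GenusTwoCollapse.lean`) this is the constant-depth
shadow of the `ℓ = 2` analogue of the crux. [cite: BernasconiDammShparlinski2000, §1 (main theorem)] -/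
theorem fund_not_mem_AC0 : encodingNatBool.toLanguage {d : ℕ | IsNegFundamentalDiscr d} ∉ AC0 :=
  not_mem_AC0_of_shiftPairs {d : ℕ | IsNegFundamentalDiscr d}
    (fun _ h3 hs => (isNegFundamentalDiscr_iff_squarefree_of_mod_four h3).2 hs)
    (fun _ h3 hf => (isNegFundamentalDiscr_iff_squarefree_of_mod_four h3).1 hf)

/-- The apex dominates its rung, formally: `AC⁰ ⊆ P/poly`, so `SQUAREFREES ∉ P/poly` would in
particular give `squarefree_not_mem_AC0` — recorded to place the rung UNDER the registered apex
`stub_sqfreeNotPPoly` of skeleton v7 (the rung is what is proved; the apex stays hypothesis-type).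
[cite: AroraBarak2009, §14.1] -/
theorem squarefree_not_mem_AC0_of_not_mem_PPoly
    (h : encodingNatBool.toLanguage {m : ℕ | Squarefree m} ∉ PPoly) :
    encodingNatBool.toLanguage {m : ℕ | Squarefree m} ∉ AC0 :=
  fun hA => h (AC0Mod_subset_PPoly two_pos (AC0_subset_AC0Mod 2 hA))

end Summit.QuantumAdvantage.QuantumAdvantage.Theorems.IqThreeNotPPoly

end
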